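import Summits.QuantumFields.BalabanUV.Beta.KernelLegPullback
import Summits.QuantumFields.BalabanUV.Beta.SpineRecursiveParity

/-!
# `BalabanUV.Beta.GAN24.CubicSectorLegPullback` — binder row G-an2-4 ∕ (CONV-C), W-slot CT-W, conservation law (C)∕(C)sym AT LEVELS `j + 1 ≥ 1`, THE FIRST BRICK (T2 of this lineage's
# note `HOME/b2b-balaban-gan24-formalise-leaf-04/g68/EXIT-FACE-CURRENT-TOWER.md`) OF THE DESCENT OF HYPOTHESIS (D) OF 24_j: **THE COARSE DIVERGENCE OF A LEG OF THE VALUE-FUNCTION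
# CUBIC TABLE `e3OfK Lc G_j S` IS THE FINE BLOCK PURE GAUGE READ ONE LEVEL DOWN THROUGH THE DRESSED CHAIN-RULE VERTEX** — per slot bond, per opposite leg, for ANY local table
# family `S` (an2 g48's leg pull-back `KernelLegPullback.mulLeg_coarseDiv_comp_coDressKBmAt_KInvStep` applied to `A = G_j ∘ vertexOfK G_j Lc S κ t` under the `mm`-read); for the
# FIRST leg by the leg antisymmetry of parity-odd tables (d1-leaf-05's `SpineRecursiveParity.trK_e3OfK_of_rows`)

NOT IN PRINT; OUR BOOKKEEPING ([folklore] kernel algebra BY NAME over an2 g48's `KernelLegPullback` (p367797 ✓), an2's `ValueJetGeneric.e3OfK_apply`, an5's `TameKernelCalculus`,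
d1-leaf-05's `SpineRecursiveParity`, leaf-02's `BubbleParity`; G-an2-4 formalisation swarm, leaf prover `b2b-balaban-gan24-formalise-leaf-04`, gen 68).  HONEST FRAMING (cell contract,
verbatim): «discharging `BetaPertH` makes Bałaban's UV stability UNCONDITIONAL — a real constructive-QFT result; it is NOT the continuum limit and NOT the Clay problem.»  HONEST
DEPENDENCY (verbatim): «continuum YM on T⁴ ⇐ BetaPertH ∧ nine spine estimates (0/9 proved); BetaPertH ⇐ (D1) ∧ (D4) ∧ CAP+tail; G-an2-4 gates asym, D1 and NE2/3/4.»

WHY.  24_{j+1} (`VHWordsZeroLatticeStep`) holds under (D) «the level-`(j+1)` exit-face current is divergence-free» (ENGINE R-leaf04-g68-1: 9.4e-16 at level 1) and (Z) (discharged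
generically by `ExitFaceCurrentCellTotals`).  (D) descends: the current is a face∕constant contraction of `e3OfK Lc G_j (SrecAt j)`, whose legs are multiplier legs of
`G_j ∘ vertexOfK G_j Lc S_j κ t ∘ G_j` read at the coarse points, and the coarse divergence of such a leg is the H-column Ward identity of `G_j` (an2's `colH_ward_KInvStep_all`):
`cH_j ×` the fine gradient of the block indicator inserted on the field leg of `G_j ∘ vertexOfK …`.  This file states that brick for the bare table, both legs.

WHAT ([folklore]; generic `d`, in-block root `ρ = toSite r`, `[NeZero Lc]`, every `j`, ANY local table family `S` on the step-`j` lattice; 0 `def`, 0 cited facts, 0 `def … : Prop`,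
0 sorry), with `G_j = coDressKBmAt ρ Lc (KInvStep Lc j)`, `V = e3OfK Lc G_j S`, `cH_j = (stepScale d Lc j·Lc^{d+1})⁻¹`:
**`e3OfK_sndLeg_coarseDiv`**: `Σ_μ (V κ t x′ (y − e_μ) (inl a) (inl μ) − V κ t x′ y (inl a) (inl μ)) = −cH_j·Σ'_v Σ_κ′ (G_j ∘ vertexOfK G_j Lc S κ t) (Lc•x′) v (inr a) (inl κ′)·gaugeWt Lc y κ′ v`;
**`e3OfK_fstLeg_coarseDiv`** (parity-odd `S`: `trK (S κ u) = −sgnK (S κ u)`): `Σ_μ (V κ t (y − e_μ) z′ (inl μ) (inl b) − V κ t y z′ (inl μ) (inl b)) = +cH_j·Σ'_v Σ_κ′ (G_j ∘ vertexOfK G_j Lc S κ t)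
(Lc•z′) v (inr b) (inl κ′)·gaugeWt Lc y κ′ v`.  Asserts NO value of Bałaban's tables; discharges NOTHING of (C)sym ∕ (Q-D) ∕ (Q-D-rate) ∕ «T2Shape» ∕ «T2Drift» ∕ (hW, hWall); NEVER
«G-an2-4 closed» as (CONV-C); NOT D1, NOT `BetaPertH`, NOT continuum, NOT Clay.  2026-08-23; no existing file touched.
-/

noncomputable section

open Finset
open scoped BigOperators
open Literature.MathematicalPhysics.QuantumFieldTheory
open Literature.MathematicalPhysics.QuantumFieldTheory.Balaban1983to89
open Literature.MathematicalPhysics.QuantumFieldTheory.Balaban1983to89.Beta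
open ExpKernelCalculus (MKer comp)
open AffineAveraging (box toSite)
open B6BondElimination (unitVec)
open OneStepResolventKernel (Fib LocStencil)
open OneStepKernelFamily (KInvStep vertexOfK)
open BalabanStepJetsSucc (mmRead mmRead_inl_inl)
open Summit.QuantumFields.BalabanUV.Beta.TameKernelCalculus
open Summit.QuantumFields.BalabanUV.Beta.AxialDressingRooted (coDressKBmAt spr_coDressKBmAt one_le_of_neZero decays_coDressKBmAt_KInvStep)
open Summit.QuantumFields.BalabanUV.Beta.BorderedHessian (stepScale spr_KInvStep sgnK sgnK_apply sgnF_inl)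
open Summit.QuantumFields.BalabanUV.Beta.KernelWardRelative (gaugeWt)
open Summit.QuantumFields.BalabanUV.Beta.KernelLegPullback (mulLeg_coarseDiv_comp_coDressKBmAt_KInvStep)
open Summit.QuantumFields.BalabanUV.Beta.SpineRooted (e3OfK e3OfK_apply)
open Summit.QuantumFields.BalabanUV.Beta.SpineRecursiveParity (trK_e3OfK_of_rows)
open Summit.QuantumFields.BalabanUV.Beta.BubbleParity (trK_coDressKBmAt_KInvStep spr_of_decays)
open Summit.QuantumFields.BalabanUV.Beta.VertexSandwichTransport (loc_vertexOfK)

namespace Summit.QuantumFields.BalabanUV.Beta.GAN24.CubicSectorLegPullback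

variable {d : ℕ} {Lc : ℕ} [NeZero Lc] {r : Fin (d + 1) → ℕ} {S : Fin (d + 1) → (Fin (d + 1) → ℤ) → MKer (d + 1) (Fib d)} {Cs δs : ℝ}

/-- [folklore] **THE COARSE DIVERGENCE OF THE SECOND LEG OF `e3OfK Lc G_j S`** (per slot bond `(κ, t)`, per first leg `(x′, inl a)`; ANY local `S`):
`Σ_μ (V κ t x′ (y − e_μ) (inl a) (inl μ) − V κ t x′ y (inl a) (inl μ)) = −cH_j·Σ'_v Σ_κ′ (G_j ∘ vertexOfK G_j Lc S κ t) (Lc•x′) v (inr a) (inl κ′)·gaugeWt Lc y κ′ v` —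
`e3OfK = −mmRead Lc (G_j ∘ vertexOfK … ∘ G_j)` and an2's `mulLeg_coarseDiv_comp_coDressKBmAt_KInvStep` with `A = G_j ∘ vertexOfK G_j Lc S κ t` (tame: spread ∘ local). -/
theorem e3OfK_sndLeg_coarseDiv (hr : r ∈ box (d + 1) Lc) (j : ℕ) (hS : LocStencil S Cs δs) (hδs : 0 < δs)
    (κ : Fin (d + 1)) (t x' y : Fin (d + 1) → ℤ) (a : Fin (d + 1)) :
    ∑ μ, (e3OfK Lc (coDressKBmAt (toSite r) Lc (KInvStep (d := d) Lc j)) S κ t x' (y - unitVec μ) (Sum.inl a) (Sum.inl μ)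
        - e3OfK Lc (coDressKBmAt (toSite r) Lc (KInvStep (d := d) Lc j)) S κ t x' y (Sum.inl a) (Sum.inl μ)) =
      -((stepScale d Lc j * (Lc : ℝ) ^ (d + 1))⁻¹ *
        ∑' v, ∑ κ', comp (coDressKBmAt (toSite r) Lc (KInvStep (d := d) Lc j)) (vertexOfK (coDressKBmAt (toSite r) Lc (KInvStep (d := d) Lc j)) Lc S κ t)
          ((Lc : ℤ) • x') v (Sum.inr a) (Sum.inl κ') * gaugeWt Lc y κ' v) := by
  set G := coDressKBmAt (toSite r) Lc (KInvStep (d := d) Lc j) with hGdef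
  have hG : Spr G := spr_coDressKBmAt (one_le_of_neZero Lc) hr (spr_KInvStep j)
  have hA : Tame (comp G (vertexOfK G Lc S κ t)) := (hG.comp_loc (loc_vertexOfK (N := Lc) hG hS hδs κ t)).tame
  have e : ∀ (z : Fin (d + 1) → ℤ) (μ : Fin (d + 1)), e3OfK Lc G S κ t x' z (Sum.inl a) (Sum.inl μ) =
      -(comp (comp G (vertexOfK G Lc S κ t)) G ((Lc : ℤ) • x') ((Lc : ℤ) • z) (Sum.inr a) (Sum.inr μ)) := by
    intro z μ
    rw [e3OfK_apply, mmRead_inl_inl]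
  simp only [e, neg_sub_neg]
  rw [show (∑ μ : Fin (d + 1), (comp (comp G (vertexOfK G Lc S κ t)) G ((Lc : ℤ) • x') ((Lc : ℤ) • y) (Sum.inr a) (Sum.inr μ)
      - comp (comp G (vertexOfK G Lc S κ t)) G ((Lc : ℤ) • x') ((Lc : ℤ) • (y - unitVec μ)) (Sum.inr a) (Sum.inr μ))) =
      -∑ μ : Fin (d + 1), (comp (comp G (vertexOfK G Lc S κ t)) G ((Lc : ℤ) • x') ((Lc : ℤ) • (y - unitVec μ)) (Sum.inr a) (Sum.inr μ)
      - comp (comp G (vertexOfK G Lc S κ t)) G ((Lc : ℤ) • x') ((Lc : ℤ) • y) (Sum.inr a) (Sum.inr μ)) by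
    rw [← Finset.sum_neg_distrib]; exact Finset.sum_congr rfl fun μ _ => by ring]
  rw [mulLeg_coarseDiv_comp_coDressKBmAt_KInvStep hr j hA ((Lc : ℤ) • x') (Sum.inr a) y]

/-- [folklore] **THE COARSE DIVERGENCE OF THE FIRST LEG**, for a table family with parity-odd rows (`trK (S κ u) = −sgnK (S κ u)` — every `SrecAt j`, d1-leaf-05's `trK_SrecAt`): the
cubic table is then antisymmetric on its ff legs (`trK_e3OfK_of_rows`), so the first-leg divergence is MINUS the second-leg one with the legs exchanged:
`Σ_μ (V κ t (y − e_μ) z′ (inl μ) (inl b) − V κ t y z′ (inl μ) (inl b)) = +cH_j·Σ'_v Σ_κ′ (G_j ∘ vertexOfK G_j Lc S κ t) (Lc•z′) v (inr b) (inl κ′)·gaugeWt Lc y κ′ v`. -/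
theorem e3OfK_fstLeg_coarseDiv (hr : r ∈ box (d + 1) Lc) (j : ℕ) (hS : LocStencil S Cs δs) (hδs : 0 < δs) (hpar : ∀ κ u, trK (S κ u) = -sgnK (S κ u))
    (κ : Fin (d + 1)) (t y z' : Fin (d + 1) → ℤ) (b : Fin (d + 1)) :
    ∑ μ, (e3OfK Lc (coDressKBmAt (toSite r) Lc (KInvStep (d := d) Lc j)) S κ t (y - unitVec μ) z' (Sum.inl μ) (Sum.inl b)
        - e3OfK Lc (coDressKBmAt (toSite r) Lc (KInvStep (d := d) Lc j)) S κ t y z' (Sum.inl μ) (Sum.inl b)) =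
      (stepScale d Lc j * (Lc : ℝ) ^ (d + 1))⁻¹ *
        ∑' v, ∑ κ', comp (coDressKBmAt (toSite r) Lc (KInvStep (d := d) Lc j)) (vertexOfK (coDressKBmAt (toSite r) Lc (KInvStep (d := d) Lc j)) Lc S κ t)
          ((Lc : ℤ) • z') v (Sum.inr b) (Sum.inl κ') * gaugeWt Lc y κ' v := by
  set G := coDressKBmAt (toSite r) Lc (KInvStep (d := d) Lc j) with hGdef
  have hG : Spr G := spr_coDressKBmAt (one_le_of_neZero Lc) hr (spr_KInvStep j)
  have hVpar := trK_e3OfK_of_rows (N := Lc) hG (trK_coDressKBmAt_KInvStep hr j) hS hδs hpar κ t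
  -- leg antisymmetry on the ff block
  have anti : ∀ (x z : Fin (d + 1) → ℤ) (α β : Fin (d + 1)), e3OfK Lc G S κ t x z (Sum.inl α) (Sum.inl β) = -e3OfK Lc G S κ t z x (Sum.inl β) (Sum.inl α) := by
    intro x z α β
    have h := congrFun (congrFun (congrFun (congrFun hVpar z) x) (Sum.inl β)) (Sum.inl α)
    simp only [trK_apply, Pi.neg_apply, sgnK_apply, sgnF_inl, one_mul] at h
    exact h
  have e : ∀ μ : Fin (d + 1), e3OfK Lc G S κ t (y - unitVec μ) z' (Sum.inl μ) (Sum.inl b) - e3OfK Lc G S κ t y z' (Sum.inl μ) (Sum.inl b) =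
      -(e3OfK Lc G S κ t z' (y - unitVec μ) (Sum.inl b) (Sum.inl μ) - e3OfK Lc G S κ t z' y (Sum.inl b) (Sum.inl μ)) := by
    intro μ
    rw [anti (y - unitVec μ) z' μ b, anti y z' μ b]
    ring
  rw [Finset.sum_congr rfl fun μ _ => e μ, Finset.sum_neg_distrib, e3OfK_sndLeg_coarseDiv hr j hS hδs κ t z' y b, neg_neg]

end Summit.QuantumFields.BalabanUV.Beta.GAN24.CubicSectorLegPullback

end
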